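import Mathlib
import Summits.Ventures.PercRepro2.HCov
import Summits.Ventures.PercRepro2.A3Fibre
import Summits.Ventures.PercRepro2.A3FibreA
import Summits.Ventures.PercRepro2.A3FibreLeft
import Summits.Ventures.PercRepro2.A3FibreWorlds
import Summits.Ventures.PercRepro2.A3FibreMain
import Summits.Ventures.PercRepro2.BHKEvents
import Summits.Ventures.PercRepro2.A3RootEdgeFibre
import Summits.Ventures.PercRepro2.A3RootEdgeMeans
import Summits.Ventures.PercRepro2.A3RootEdgeClusterFns
import Summits.Ventures.PercRepro2.A3RootEdgeBetween
import Summits.Ventures.PercRepro2.A3BetweenSwap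

/-!
# (MEANS-a₃) when `PD` and `T` are null — part 1 of the `D = 0` case
(blind cell PercRepro2, p5 g14; `proofs/P5-ROOTEDGE.md` §7, the `D = 0` caveat)

When `D = P(PD) = 0` the `A`-fibres of the a₃-exploration carry no mass.  If moreover `T = Q ∩ {a₃ ∈ C₂}`
is null (so `T′ = Q` almost surely), every fibre with `a₁ ∉ W` is null (`fibre ⊆ PD ∪ T`), and on the
fibres with `a₁ ∈ W`, `a₂ ∉ W` the fibre masses are `mW · cbS(W)`, `mW · cFS(W)` (A3RootEdgeFibre's
`Ssig_eq_mul` / `Su_eq_mul`, no pinning needed).  Hence `btw = E[cbS cFS (C(a₃)) 1_Q] −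
E[cbS (C(a₃)) 1_Q] E[cFS (C(a₃)) 1_Q] / P(Q)`; on `Q` the clusters of `a₃` and `a₁` agree off the null
set `PD ∪ T`, so the expectations are those of the cluster of `a₁`, and BHK 1.3 for the monotone
functions `cbS`, `cFS` of `C(a₁)` given `a₁ ↮ a₂` (`bhk_same_cluster`) gives `btw ≥ 0`
(**`A3Between_of_T_null`**; the `T′`-null case by the root swap `A3Between_swap`).  The DICHOTOMY
(**`T_null_or_T'_null_of_PD_null`**): `P(Q) > 0` and `P(PD) = 0` force `P(T) = 0` or `P(T′) = 0` — the
meet of a positive-weight configuration of `T` with one of `T′` has positive weight, lies in `Q`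
(decreasing) and has `a₃ ∉ C₁ ∪ C₂` (monotonicity of connection), i.e. lies in `PD`.  Together:
**`A3Between_of_PD_null`** — (MEANS-a₃) holds whenever `D = 0` — and the `_all`-level equivalence
**`A3Between_all_iff_noRootEdge_all : A3Between_all R ↔ A3BetweenNoRootEdge_all R`** with no
`D > 0` proviso (A3BetweenSwap's `A3Between_of_noRootEdge_class` for `D > 0`).
-/

namespace Summit.Ventures.PercRepro2

open UnionCluster

namespace CovForm

namespace RootEdge

open CCT A3Fibre

section Null

variable {V : Type*} {E : Type*} [Fintype V] [DecidableEq V] [Fintype E] [DecidableEq E]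
  {R : Type*} [Field R] [LinearOrder R] [IsStrictOrderedRing R]

variable {ends : E → Sym2 V} {a₁ a₂ a₃ : V}

omit [Fintype V] [DecidableEq V] [Fintype E] [DecidableEq E] [LinearOrder R]
  [IsStrictOrderedRing R] in
/-- A fibre with `a₁ ∉ W` lies in `PD ∪ T`. -/
lemma fibre_subset_PD_union_T {W : Finset V} (h₁ : a₁ ∉ W) :
    fibre ends a₁ a₂ a₃ W ⊆ PDEvent ends a₁ a₂ a₃ ∪ TEvent ends a₁ a₂ a₃ := by
  intro ω hω
  simp only [fibre, Set.mem_inter_iff, mem_clusterEvent, mem_avoidAll, Finset.mem_singleton,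
    forall_eq] at hω
  obtain ⟨hQ, hW⟩ := hω
  have h31 : ¬ Conn ends ω a₃ a₁ := by
    intro hc
    apply h₁
    have : a₁ ∈ cluster ends ω a₃ := hc
    rw [hW] at this
    exact Finset.mem_coe.1 this
  by_cases h32 : Conn ends ω a₂ a₃
  · right
    exact ⟨hQ, h32⟩
  · left
    refine ⟨fun hc => hQ (conn_symm hc), ?_⟩
    simp only [Dtilde, Set.mem_compl_iff, mem_inU, not_or]
    exact ⟨h31, fun hc => h32 (conn_symm hc)⟩

omit [Fintype V] [DecidableEq V] in
/-- With `PD` and `T` null, every fibre with `a₁ ∉ W` is null. -/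
lemma prob_fibre_inter_eq_zero_of_notMem (p : E → R) (hp : IsProbVec p)
    (hPD : prob p (PDEvent ends a₁ a₂ a₃) = 0) (hT : prob p (TEvent ends a₁ a₂ a₃) = 0)
    {W : Finset V} (h₁ : a₁ ∉ W) (X : Set (Config E)) :
    prob p (fibre ends a₁ a₂ a₃ W ∩ X) = 0 := by
  refine le_antisymm ?_ (prob_nonneg hp _)
  calc prob p (fibre ends a₁ a₂ a₃ W ∩ X)
      ≤ prob p (PDEvent ends a₁ a₂ a₃ ∪ TEvent ends a₁ a₂ a₃) :=
        prob_mono hp (Set.Subset.trans Set.inter_subset_left (fibre_subset_PD_union_T h₁))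
    _ ≤ prob p (PDEvent ends a₁ a₂ a₃) + prob p (TEvent ends a₁ a₂ a₃) := prob_union_le hp _ _
    _ = 0 := by rw [hPD, hT, add_zero]

omit [Fintype V] [DecidableEq V] in
/-- `mW`, `Ssig`, `Su` vanish on the null fibres. -/
lemma masses_eq_zero_of_null (p : E → R) (hp : IsProbVec p)
    (hPD : prob p (PDEvent ends a₁ a₂ a₃) = 0) (hT : prob p (TEvent ends a₁ a₂ a₃) = 0)
    {W : Finset V} (h₁ : a₁ ∉ W) (v : V) :
    mW p ends a₁ a₂ a₃ W = 0 ∧ Ssig p ends a₁ a₂ a₃ v W = 0 ∧ Su p ends a₁ a₂ a₃ v W = 0 := by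
  have h := prob_fibre_inter_eq_zero_of_notMem p hp hPD hT h₁
  refine ⟨?_, ?_, ?_⟩
  · have := h Set.univ
    simpa only [Set.inter_univ, mW] using this
  · unfold Ssig; rw [h, h, sub_zero]
  · unfold Su; rw [h, h, add_zero]

/-- **`Ssig = mW · cbS` on every fibre** when `PD`, `T` are null. -/
lemma Ssig_eq_mW_mul_cbS (p : E → R) (hp : IsProbVec p)
    (hPD : prob p (PDEvent ends a₁ a₂ a₃) = 0) (hT : prob p (TEvent ends a₁ a₂ a₃) = 0) (b : V)
    (W : Finset V) :
    Ssig p ends a₁ a₂ a₃ b W = mW p ends a₁ a₂ a₃ W * cbS p ends a₂ b (↑W : Set V) := by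
  rw [cbS_coe]
  by_cases h₁ : a₁ ∈ W
  · by_cases h₂ : a₂ ∈ W
    · have hm : mW p ends a₁ a₂ a₃ W = 0 := by
        unfold mW; rw [fibre_eq_empty_of_mem_mem ends a₁ a₂ a₃ h₁ h₂, prob_empty]
      have hs : Ssig p ends a₁ a₂ a₃ b W = 0 := by
        unfold Ssig; rw [fibre_eq_empty_of_mem_mem ends a₁ a₂ a₃ h₁ h₂]; simp
      rw [hm, hs]; ring
    · exact Ssig_eq_mul p h₁ h₂ b
  · obtain ⟨hm, hs, -⟩ := masses_eq_zero_of_null p hp hPD hT h₁ b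
    rw [hm, hs]; ring

/-- **`SF = mW · cFS` on every fibre** when `PD`, `T` are null (at `γ = gamma p`). -/
lemma SF_eq_mW_mul_cFS (p : E → R) (hp : IsProbVec p)
    (hPD : prob p (PDEvent ends a₁ a₂ a₃) = 0) (hT : prob p (TEvent ends a₁ a₂ a₃) = 0) (o : V)
    (W : Finset V) :
    SF p ends o a₁ a₂ a₃ W =
      mW p ends a₁ a₂ a₃ W * cFS p ends a₂ o (gamma p ends o a₁ a₂ a₃) (↑W : Set V) := by
  rw [cFS_coe]
  by_cases h₁ : a₁ ∈ W
  · by_cases h₂ : a₂ ∈ W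
    · have hm : mW p ends a₁ a₂ a₃ W = 0 := by
        unfold mW; rw [fibre_eq_empty_of_mem_mem ends a₁ a₂ a₃ h₁ h₂, prob_empty]
      have hs : SF p ends o a₁ a₂ a₃ W = 0 := by
        unfold SF Ssig Su mW; rw [fibre_eq_empty_of_mem_mem ends a₁ a₂ a₃ h₁ h₂]; simp
      rw [hm, hs]; ring
    · have hs3 : s3 a₁ a₂ W = (1 : R) := by simp [s3, h₁]
      unfold SF
      rw [Ssig_eq_mul p h₁ h₂ o, Su_eq_mul p h₁ h₂ o, hs3]
      split_ifs <;> ring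
  · obtain ⟨hm, hs, hu⟩ := masses_eq_zero_of_null p hp hPD hT h₁ o
    unfold SF
    rw [hm, hs, hu]; ring

/-- The `Ssig·SF/mW` term is `mW · cbS · cFS` on every fibre. -/
lemma term_eq_of_null (p : E → R) (hp : IsProbVec p)
    (hPD : prob p (PDEvent ends a₁ a₂ a₃) = 0) (hT : prob p (TEvent ends a₁ a₂ a₃) = 0) (o b : V)
    (W : Finset V) :
    Ssig p ends a₁ a₂ a₃ b W * SF p ends o a₁ a₂ a₃ W / mW p ends a₁ a₂ a₃ W =
      mW p ends a₁ a₂ a₃ W *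
        (cbS p ends a₂ b (↑W : Set V) * cFS p ends a₂ o (gamma p ends o a₁ a₂ a₃) (↑W : Set V)) := by
  rw [Ssig_eq_mW_mul_cbS p hp hPD hT b W, SF_eq_mW_mul_cFS p hp hPD hT o W, mul_mul_div_self]

omit [DecidableEq V] [LinearOrder R] [IsStrictOrderedRing R] in
/-- A fibre sum `∑_W F(W) · mW(W)` is the expectation `E[F(C(a₃)) · 1_Q]`. -/
lemma sum_mW_mul_eq_expect (p : E → R) (F : Set V → R) :
    (∑ W : Finset V, mW p ends a₁ a₂ a₃ W * F (↑W : Set V)) =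
      expect p (fun ω => F (cluster ends ω a₃) * (avoidAll ends a₂ {a₁}).indicator 1 ω) := by
  rw [expect_cluster_mul_indicator]
  refine Finset.sum_congr rfl fun W _ => ?_
  unfold mW fibre
  rw [Set.inter_comm, mul_comm]

/-- A configuration of a null event has zero weight. -/
lemma weight_eq_zero_of_mem_null (p : E → R) (hp : IsProbVec p) {N : Set (Config E)}
    (hN : prob p N = 0) {ω : Config E} (hω : ω ∈ N) : weight p ω = 0 := by
  unfold prob at hN
  have h := (Finset.sum_eq_zero_iff_of_nonneg
    (fun ω' _ => Set.indicator_nonneg (fun ω'' _ => weight_nonneg hp ω'') ω')).1 hN ω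
    (Finset.mem_univ ω)
  rwa [Set.indicator_of_mem hω] at h

/-- **On `Q`, the clusters of `a₃` and `a₁` agree off the null set `PD ∪ T`**: the expectations of
a cluster function times `1_Q` are the same for `C(a₃)` and `C(a₁)`. -/
lemma expect_cluster_a3_eq_a1 (p : E → R) (hp : IsProbVec p)
    (hPD : prob p (PDEvent ends a₁ a₂ a₃) = 0) (hT : prob p (TEvent ends a₁ a₂ a₃) = 0)
    (F : Set V → R) :
    expect p (fun ω => F (cluster ends ω a₃) * (avoidAll ends a₂ {a₁}).indicator 1 ω) =
      expect p (fun ω => F (cluster ends ω a₁) * (avoidAll ends a₂ {a₁}).indicator 1 ω) := by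
  have hle : prob p (PDEvent ends a₁ a₂ a₃ ∪ TEvent ends a₁ a₂ a₃) ≤ 0 := by
    calc prob p (PDEvent ends a₁ a₂ a₃ ∪ TEvent ends a₁ a₂ a₃)
        ≤ prob p (PDEvent ends a₁ a₂ a₃) + prob p (TEvent ends a₁ a₂ a₃) := prob_union_le hp _ _
      _ = 0 := by rw [hPD, hT, add_zero]
  have hN : prob p (PDEvent ends a₁ a₂ a₃ ∪ TEvent ends a₁ a₂ a₃) = 0 :=
    le_antisymm hle (prob_nonneg hp _)
  unfold expect
  refine Finset.sum_congr rfl fun ω _ => ?_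
  beta_reduce
  by_cases hQ : ω ∈ avoidAll ends a₂ {a₁}
  · by_cases h13 : Conn ends ω a₃ a₁
    · rw [cluster_eq_of_conn h13]
    · -- `ω ∈ PD ∪ T`: zero weight
      have hmem : ω ∈ PDEvent ends a₁ a₂ a₃ ∪ TEvent ends a₁ a₂ a₃ := by
        simp only [mem_avoidAll, Finset.mem_singleton, forall_eq] at hQ
        by_cases h32 : Conn ends ω a₂ a₃
        · exact Or.inr ⟨hQ, h32⟩
        · refine Or.inl ⟨fun hc => hQ (conn_symm hc), ?_⟩
          simp only [Dtilde, Set.mem_compl_iff, mem_inU, not_or]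
          exact ⟨h13, fun hc => h32 (conn_symm hc)⟩
      rw [weight_eq_zero_of_mem_null p hp hN hmem]
      ring
  · rw [Set.indicator_of_notMem hQ]
    ring

/-- **(MEANS-a₃) when `PD` and `T` are null** (`T′ = Q` almost surely): BHK 1.3 for the monotone
functions `cbS`, `cFS` of the cluster of `a₁` given `a₁ ↮ a₂`. -/
theorem A3Between_of_T_null (p : E → R) (hp : IsProbVec p) (o b : V)
    (hPD : prob p (PDEvent ends a₁ a₂ a₃) = 0) (hT : prob p (TEvent ends a₁ a₂ a₃) = 0) :
    A3Between p ends o a₁ a₂ a₃ b := by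
  set γ := gamma p ends o a₁ a₂ a₃ with hγdef
  have hγ : 0 ≤ γ := gamma_nonneg p hp o
  have hQc : (connEvent ends a₁ a₂)ᶜ = avoidAll ends a₂ {a₁} := (avoidAll_eq_compl' ends a₁ a₂).symm
  -- BHK 1.3 for the shifted nonnegative monotone functions of `C(a₁)`
  have key := bhk_same_cluster p hp ends a₁ a₂
    (F₁ := fun S => cbS p ends a₂ b S + 1) (F₂ := fun S => cFS p ends a₂ o γ S + 2)
    (fun S S' h => by
      show cbS p ends a₂ b S + 1 ≤ cbS p ends a₂ b S' + 1
      linarith [cbS_mono p hp ends a₂ b h])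
    (fun S S' h => by
      show cFS p ends a₂ o γ S + 2 ≤ cFS p ends a₂ o γ S' + 2
      linarith [cFS_mono p hp ends a₂ o γ h])
    (fun S => cbS_add_one_nonneg p hp ends a₂ b S) (fun S => cFS_add_two_nonneg p hp ends a₂ o hγ S)
  rw [hQc] at key
  -- expand the shifted expectations
  have e1 : expect p (fun ω => (cbS p ends a₂ b (cluster ends ω a₁) + 1) *
      (avoidAll ends a₂ {a₁}).indicator 1 ω) =
      expect p (fun ω => cbS p ends a₂ b (cluster ends ω a₁) * (avoidAll ends a₂ {a₁}).indicator 1 ω) +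
        prob p (avoidAll ends a₂ {a₁}) := by
    rw [prob_eq_expect_indicator, ← expect_add]
    congr 1; funext ω
    by_cases hQ : ω ∈ avoidAll ends a₂ {a₁}
    · simp only [Pi.add_apply, Set.indicator_of_mem hQ, Pi.one_apply]; ring
    · simp only [Pi.add_apply, Set.indicator_of_notMem hQ]; ring
  have e2 : expect p (fun ω => (cFS p ends a₂ o γ (cluster ends ω a₁) + 2) *
      (avoidAll ends a₂ {a₁}).indicator 1 ω) =
      expect p (fun ω => cFS p ends a₂ o γ (cluster ends ω a₁) * (avoidAll ends a₂ {a₁}).indicator 1 ω) +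
        2 * prob p (avoidAll ends a₂ {a₁}) := by
    rw [prob_eq_expect_indicator, ← expect_const_mul, ← expect_add]
    congr 1; funext ω
    by_cases hQ : ω ∈ avoidAll ends a₂ {a₁}
    · simp only [Pi.add_apply, Set.indicator_of_mem hQ, Pi.one_apply]; ring
    · simp only [Pi.add_apply, Set.indicator_of_notMem hQ]; ring
  have e3 : expect p (fun ω => (cbS p ends a₂ b (cluster ends ω a₁) + 1) *
      (cFS p ends a₂ o γ (cluster ends ω a₁) + 2) * (avoidAll ends a₂ {a₁}).indicator 1 ω) =
      expect p (fun ω => (cbS p ends a₂ b (cluster ends ω a₁) * cFS p ends a₂ o γ (cluster ends ω a₁)) *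
          (avoidAll ends a₂ {a₁}).indicator 1 ω) +
      2 * expect p (fun ω => cbS p ends a₂ b (cluster ends ω a₁) *
        (avoidAll ends a₂ {a₁}).indicator 1 ω) +
      expect p (fun ω => cFS p ends a₂ o γ (cluster ends ω a₁) *
        (avoidAll ends a₂ {a₁}).indicator 1 ω) +
      2 * prob p (avoidAll ends a₂ {a₁}) := by
    rw [prob_eq_expect_indicator, ← expect_const_mul, ← expect_const_mul, ← expect_add, ← expect_add,
      ← expect_add]
    congr 1; funext ω
    by_cases hQ : ω ∈ avoidAll ends a₂ {a₁}
    · simp only [Pi.add_apply, Set.indicator_of_mem hQ, Pi.one_apply]; ring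
    · simp only [Pi.add_apply, Set.indicator_of_notMem hQ]; ring
  rw [e1, e2, e3] at key
  -- the fibre sums of `btw`
  have hA : ∀ W ∈ fibresA a₁ a₂, Su p ends a₁ a₂ a₃ b W * Su p ends a₁ a₂ a₃ o W /
      mW p ends a₁ a₂ a₃ W = 0 := fun W hW => by
    obtain ⟨-, -, hu⟩ := masses_eq_zero_of_null p hp hPD hT (mem_fibresA_notMem hW) b
    rw [hu]; ring
  have hA1 : ∀ W ∈ fibresA a₁ a₂, Su p ends a₁ a₂ a₃ b W = 0 := fun W hW =>
    (masses_eq_zero_of_null p hp hPD hT (mem_fibresA_notMem hW) b).2.2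
  have hterm : (∑ W : Finset V, Ssig p ends a₁ a₂ a₃ b W * SF p ends o a₁ a₂ a₃ W /
      mW p ends a₁ a₂ a₃ W) =
      expect p (fun ω => (fun S => cbS p ends a₂ b S * cFS p ends a₂ o γ S) (cluster ends ω a₁) *
        (avoidAll ends a₂ {a₁}).indicator 1 ω) := by
    rw [← expect_cluster_a3_eq_a1 p hp hPD hT (fun S => cbS p ends a₂ b S * cFS p ends a₂ o γ S),
      ← sum_mW_mul_eq_expect p (fun S => cbS p ends a₂ b S * cFS p ends a₂ o γ S)]
    refine Finset.sum_congr rfl fun W _ => ?_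
    rw [term_eq_of_null p hp hPD hT o b W]
  have hSsig : (∑ W : Finset V, Ssig p ends a₁ a₂ a₃ b W) =
      expect p (fun ω => (fun S => cbS p ends a₂ b S) (cluster ends ω a₁) *
        (avoidAll ends a₂ {a₁}).indicator 1 ω) := by
    rw [← expect_cluster_a3_eq_a1 p hp hPD hT (fun S => cbS p ends a₂ b S),
      ← sum_mW_mul_eq_expect p (fun S => cbS p ends a₂ b S)]
    refine Finset.sum_congr rfl fun W _ => ?_
    rw [Ssig_eq_mW_mul_cbS p hp hPD hT b W]
  have hSF : (∑ W : Finset V, SF p ends o a₁ a₂ a₃ W) =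
      expect p (fun ω => (fun S => cFS p ends a₂ o γ S) (cluster ends ω a₁) *
        (avoidAll ends a₂ {a₁}).indicator 1 ω) := by
    rw [← expect_cluster_a3_eq_a1 p hp hPD hT (fun S => cFS p ends a₂ o γ S),
      ← sum_mW_mul_eq_expect p (fun S => cFS p ends a₂ o γ S)]
    refine Finset.sum_congr rfl fun W _ => ?_
    rw [SF_eq_mW_mul_cFS p hp hPD hT o W]
  beta_reduce at hterm hSsig hSF
  unfold A3Between A3Fibre.btw
  rw [Finset.sum_eq_zero hA, Finset.sum_eq_zero hA1, hterm, hSsig, hSF]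
  simp only [zero_mul, zero_div, sub_zero, add_zero]
  have hQ0 := prob_nonneg hp (avoidAll ends a₂ {a₁})
  rcases eq_or_lt_of_le hQ0 with hz | hpos
  · -- `P(Q) = 0`: the expectation of a `Q`-indicator product vanishes
    rw [← hz, div_zero, sub_zero]
    unfold expect
    refine Finset.sum_nonneg fun ω _ => ?_
    beta_reduce
    by_cases hQ : ω ∈ avoidAll ends a₂ {a₁}
    · rw [weight_eq_zero_of_mem_null p hp hz.symm hQ, zero_mul]
    · rw [Set.indicator_of_notMem hQ, mul_zero, mul_zero]
  · rw [sub_nonneg, div_le_iff₀ hpos]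
    nlinarith [key]

end Null

end RootEdge

end CovForm

end Summit.Ventures.PercRepro2
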